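import Literature.Geometry.Kaehler.ComplexTorusHodgeGroupSymplecticGramLieSimple
import Literature.Geometry.Kaehler.ComplexTorusHodgeGroupComplexPointsTransport
import Literature.Geometry.Kaehler.ComplexTorusIsomorphism
import HarnessLib

/-!
# Isogeny invariance of `dim Hg(X)` and of the simplicity ∕ commutativity of `Lie Hg(X)(ℂ)`:
# `Hg(X₂)(ℂ) = P̃ · (Hg(X₁)(ℂ) reindexed) · P̃⁻¹` for isogenous `X₁ ∼ X₂`

Layer `Literature/Geometry/Kaehler`, namespace `Literature.Geometry.Kaehler.ComplexTorus`; lane `lit-hodgefound`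
(Track 2 foundations library), Layer A4; prover seat `lit-hodgefound-p17` (generation 39, self-proposed row g39-#8).
p40's `ComplexTorusHodgeGroupComplexPointsTransport` proves GGK (I.B.4) on complex points in membership form:
`N ∈ Hg(X₂)(ℂ) ⟺ N = (P ⊗ 1) M (Q ⊗ 1)` with `M ∈ Hg(X₁)(ℂ)`, for mutually inverse `P ∈ Hom_ℚ(X₁, X₂)`,
`Q ∈ Hom_ℚ(X₂, X₁)` — the two tori live on different index types `ι₁`, `ι₂` of the same cardinality. THIS FILE
rewrites it as a SUBGROUP identity `Hg(X₂)(ℂ) = conjGLC P̃ (reindexSLC e (Hg(X₁)(ℂ)))` along a bijection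
`e : ι₁ ≃ ι₂` (`P̃ = (P ⊗ 1)` with columns renamed by `e`), so that the LAG transports of g39-#7a
(`LieAlgebraGLConjReindex`: `dim`, Lie-simplicity and commutativity are invariant under `Int(g)` and reindexing) apply:
**`dim Hg(X)`, "`Lie Hg(X)(ℂ)` is simple" and "`Lie Hg(X)(ℂ)` is abelian" are isogeny invariants** — hence so are
all hypotheses of g38-#5 ∕ g39-#5…#7b. THEOREMS ONLY (no definition, no instance, no named fact; net debt 0).

## Sources, verbatim

* M. Green, P. Griffiths, M. Kerr [GreenGriffithsKerr2012], §I.B (I.B.3)–(I.B.4) (held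
  `book:green2012-mumford-tate-groups-domains-their-geometry-arithmetic` p0039 L13–L36): "`M_{ρ(φ̃)}` is the image of
  `M_φ̃` under the natural map `ρ`"; "(I.B.4) `f(Ȳ^ℚ) = \overline{f(Y)}^ℚ`."
* B. Moonen, Yu. G. Zarhin [MoonenZarhin1999LowDim], (0.2)(4) and §1: the Hodge group "up to isogeny".
* B. van Geemen [vanGeemen1994HodgeAV], 3.6: an isogeny induces an isomorphism of rational Hodge structures, hence of
  Mumford–Tate ∕ Hodge groups.
* T. A. Springer [Springer1998], 4.4.5 (ii) (`Ad(x)` is an automorphism of the Lie algebra), 1.8.1.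

## What is proved

* §1 (private `submatrix_mul_reindex_mul_submatrix`: the matrix identity `P̃ · (e·M) · Q̃ = P M Q`),
  `isUnit_det_submatrix_id_equivSymm`, `map_algebraMap_complex_mul_eq_one`, `isUnit_det_submatrix_map_algebraMap`,
  **`hodgeGroupC_eq_map_conjGLC_map_reindexSLC_of_homRat`** (the subgroup form of (I.B.4) on complex points),
  `map_toGL_hodgeGroupC_eq_of_homRat` (its `GL`-image: `Int(P̃) ∘ reindexGL e`).
* §2 for mutually inverse `P ∈ Hom_ℚ(X₁, X₂)`, `Q`, for an isogeny, for isogenous and for isomorphic tori: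
  **`IsIsogenous.zdim_hodgeGroupC_eq`** (`dim Hg(X₁) = dim Hg(X₂)`), `IsIsogenous.finrank_lieAlgebraGL_hodgeGroupC_eq`,
  **`IsIsogenous.isSimple_lieSubalgebraGL_hodgeGroupC_iff`**, **`IsIsogenous.isLieAbelian_lieSubalgebraGL_hodgeGroupC_iff`**,
  and the `IsIsomorphic` forms.

## References

* [GreenGriffithsKerr2012] M. Green, P. Griffiths, M. Kerr, *Mumford–Tate Groups and Domains*, Princeton (2012), §I.B.
* [MoonenZarhin1999LowDim] B. Moonen, Yu. G. Zarhin, Math. Ann. 315 (1999), (0.2)(4), §1.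
* [vanGeemen1994HodgeAV] B. van Geemen, LNM 1594 (1994), 3.6.
* [Springer1998] T. A. Springer, *Linear Algebraic Groups*, 2nd ed. (1998), 4.4.5 (ii), 1.8.1.
* [Lange2023AbelianVarietiesComplex] H. Lange, *Abelian Varieties over the Complex Numbers* (2023), §1.1.2.
-/

noncomputable section

open Matrix Module

namespace Literature.Geometry.Kaehler

namespace ComplexTorus

open Literature.NumberTheory.Automorphic (IsZConnected lieAlgebraGL lieSubalgebraGL reindexGL)

variable {ι₁ ι₂ : Type*} [Fintype ι₁] [DecidableEq ι₁] [Fintype ι₂] [DecidableEq ι₂]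
  {E₁ E₂ : Type*} [NormedAddCommGroup E₁] [NormedSpace ℂ E₁] [NormedAddCommGroup E₂] [NormedSpace ℂ E₂]
  {Φ₁ : (ι₁ → ℝ) ≃L[ℝ] E₁} {Φ₂ : (ι₂ → ℝ) ≃L[ℝ] E₂}

/-! ## §1 `Hg(X₂)(ℂ) = P̃ · (Hg(X₁)(ℂ))^{e} · P̃⁻¹` -/

omit [DecidableEq ι₁] [DecidableEq ι₂] in
/-- The matrix identity behind the reindexing: `P̃ (e·M) Q̃ = P M Q` with `P̃ = P ∘ (id × e⁻¹)`, `Q̃ = Q ∘ (e⁻¹ × id)`,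
`e·M = M ∘ (e⁻¹ × e⁻¹)`. [folklore] -/
private theorem submatrix_mul_reindex_mul_submatrix {R : Type*} [CommRing R] (P : Matrix ι₂ ι₁ R) (M : Matrix ι₁ ι₁ R)
    (Q : Matrix ι₁ ι₂ R) (e : ι₁ ≃ ι₂) :
    P.submatrix id e.symm * M.submatrix e.symm e.symm * Q.submatrix e.symm id = P * M * Q := by
  rw [← Matrix.submatrix_mul _ _ _ _ _ e.symm.bijective, ← Matrix.submatrix_mul _ _ _ _ _ e.symm.bijective,
    Matrix.submatrix_id_id]

omit [DecidableEq ι₁] in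
/-- For mutually inverse `P`, `Q`: `P̃ Q̃ = 1`. [folklore] -/
private theorem submatrix_mul_submatrix_eq_one {R : Type*} [CommRing R] {P : Matrix ι₂ ι₁ R} {Q : Matrix ι₁ ι₂ R}
    (hPQ : P * Q = 1) (e : ι₁ ≃ ι₂) : P.submatrix id e.symm * Q.submatrix e.symm id = 1 := by
  rw [← Matrix.submatrix_mul _ _ _ _ _ e.symm.bijective, hPQ, Matrix.submatrix_id_id]

omit [DecidableEq ι₁] in
/-- `det P̃` is a unit for mutually inverse `P`, `Q` (the rational representation of an isogeny is invertible, and so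
is its square reindexing `P̃`). [cite: Lange2023AbelianVarietiesComplex, §1.1.2 (isogenies and `Hom_ℚ`: `ρ_r(f)` is invertible)] -/
theorem isUnit_det_submatrix_id_equivSymm {R : Type*} [CommRing R] {P : Matrix ι₂ ι₁ R} {Q : Matrix ι₁ ι₂ R}
    (hPQ : P * Q = 1) (e : ι₁ ≃ ι₂) : IsUnit (P.submatrix id e.symm).det :=
  Matrix.isUnit_det_of_right_inverse (submatrix_mul_submatrix_eq_one hPQ e)

omit [DecidableEq ι₁] [Fintype ι₂] in
/-- `(P ⊗ 1)(Q ⊗ 1) = 1` over `ℂ` for mutually inverse rational `P`, `Q` (extension of scalars of the rational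
representation). [cite: Lange2023AbelianVarietiesComplex, §1.1.2 (`ρ_r ⊗ ℂ = ρ_a ⊕ ρ̄_a`)] -/
theorem map_algebraMap_complex_mul_eq_one {P : Matrix ι₂ ι₁ ℚ} {Q : Matrix ι₁ ι₂ ℚ} (hPQ : P * Q = 1) :
    P.map (algebraMap ℚ ℂ) * Q.map (algebraMap ℚ ℂ) = 1 := by
  rw [← Matrix.map_mul, hPQ, Matrix.map_one _ (map_zero _) (map_one _)]

omit [DecidableEq ι₁] in
/-- `det (P̃ ⊗ 1)` is a unit over `ℂ` for mutually inverse rational `P`, `Q`. [cite: Lange2023AbelianVarietiesComplex, §1.1.2] -/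
theorem isUnit_det_submatrix_map_algebraMap {P : Matrix ι₂ ι₁ ℚ} {Q : Matrix ι₁ ι₂ ℚ} (hPQ : P * Q = 1) (e : ι₁ ≃ ι₂) :
    IsUnit ((P.map (algebraMap ℚ ℂ)).submatrix id e.symm).det :=
  isUnit_det_submatrix_id_equivSymm (map_algebraMap_complex_mul_eq_one hPQ) e

/-- **GGK (I.B.4) on complex points, subgroup form: `Hg(X₂)(ℂ) = P̃ · (Hg(X₁)(ℂ) reindexed along e) · P̃⁻¹`** for
mutually inverse `P ∈ Hom_ℚ(X₁, X₂)`, `Q ∈ Hom_ℚ(X₂, X₁)` and any bijection `e : ι₁ ≃ ι₂` of the lattice bases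
(`P̃ = (P ⊗ 1)` with columns renamed by `e`). [cite: GreenGriffithsKerr2012, §I.B (I.B.3), (I.B.4)] [cite: vanGeemen1994HodgeAV, 3.6]
[cite: MoonenZarhin1999LowDim, (0.2)(4)] -/
theorem hodgeGroupC_eq_map_conjGLC_map_reindexSLC_of_homRat {P : Matrix ι₂ ι₁ ℚ} {Q : Matrix ι₁ ι₂ ℚ}
    (hP : P ∈ homRat Φ₁ Φ₂) (hQP : Q * P = 1) (hPQ : P * Q = 1) (e : ι₁ ≃ ι₂)
    (hdet : IsUnit ((P.map (algebraMap ℚ ℂ)).submatrix id e.symm).det) :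
    hodgeGroupC Φ₂ = ((hodgeGroupC Φ₁).map (reindexSLC e).toMonoidHom).map
      (conjGLC ((P.map (algebraMap ℚ ℂ)).submatrix id e.symm) hdet).toMonoidHom := by
  have hPQc : P.map (algebraMap ℚ ℂ) * Q.map (algebraMap ℚ ℂ) = 1 := map_algebraMap_complex_mul_eq_one hPQ
  have hinv : ((P.map (algebraMap ℚ ℂ)).submatrix id e.symm)⁻¹ = (Q.map (algebraMap ℚ ℂ)).submatrix e.symm id :=
    Matrix.inv_eq_right_inv (submatrix_mul_submatrix_eq_one hPQc e)
  ext N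
  rw [mem_hodgeGroupC_iff_of_homRat hP hQP hPQ, Subgroup.mem_map]
  constructor
  · rintro ⟨M, hM, hMN⟩
    refine ⟨reindexSLC e M, Subgroup.mem_map_of_mem _ hM, Subtype.ext ?_⟩
    change (P.map (algebraMap ℚ ℂ)).submatrix id e.symm * (M : Matrix ι₁ ι₁ ℂ).submatrix e.symm e.symm *
      ((P.map (algebraMap ℚ ℂ)).submatrix id e.symm)⁻¹ = (N : Matrix ι₂ ι₂ ℂ)
    rw [hinv, submatrix_mul_reindex_mul_submatrix, hMN]
  · rintro ⟨M', hM', hM'N⟩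
    obtain ⟨M, hM, rfl⟩ := Subgroup.mem_map.1 hM'
    refine ⟨M, hM, ?_⟩
    rw [← hM'N]
    change _ = (P.map (algebraMap ℚ ℂ)).submatrix id e.symm * (M : Matrix ι₁ ι₁ ℂ).submatrix e.symm e.symm *
      ((P.map (algebraMap ℚ ℂ)).submatrix id e.symm)⁻¹
    rw [hinv, submatrix_mul_reindex_mul_submatrix]

/-- The `GL`-image: `Hg(X₂)(ℂ) = Int(P̃)(reindexGL e (Hg(X₁)(ℂ)))` inside `GL(V₂,ℂ)`. [cite: GreenGriffithsKerr2012, §I.B (I.B.4)]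
[cite: Springer1998, 4.4.5 (ii)] -/
theorem map_toGL_hodgeGroupC_eq_of_homRat {P : Matrix ι₂ ι₁ ℚ} {Q : Matrix ι₁ ι₂ ℚ} (hP : P ∈ homRat Φ₁ Φ₂)
    (hQP : Q * P = 1) (hPQ : P * Q = 1) (e : ι₁ ≃ ι₂) (hdet : IsUnit ((P.map (algebraMap ℚ ℂ)).submatrix id e.symm).det) :
    (hodgeGroupC Φ₂).map Matrix.SpecialLinearGroup.toGL =
      (((hodgeGroupC Φ₁).map Matrix.SpecialLinearGroup.toGL).map (reindexGL e).toMonoidHom).map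
        (MulAut.conj (Matrix.GeneralLinearGroup.mk'' ((P.map (algebraMap ℚ ℂ)).submatrix id e.symm) hdet) :
          GL ι₂ ℂ →* GL ι₂ ℂ) := by
  rw [hodgeGroupC_eq_map_conjGLC_map_reindexSLC_of_homRat hP hQP hPQ e hdet, map_toGL_map_conjGLC, map_toGL_map_reindexSLC]

/-! ## §2 Isogeny invariance of `dim Hg(X)` and of simplicity ∕ commutativity of `Lie Hg(X)(ℂ)` -/

/-- **`dim Hg(X₂) = dim Hg(X₁)`** for mutually inverse `P ∈ Hom_ℚ(X₁, X₂)`, `Q` (`|ι₁| = |ι₂|`).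
[cite: GreenGriffithsKerr2012, §I.B (I.B.4)] [cite: Springer1998, 4.4.5 (ii) and 1.8.1] -/
theorem zdim_hodgeGroupC_eq_of_homRat {P : Matrix ι₂ ι₁ ℚ} {Q : Matrix ι₁ ι₂ ℚ} (hP : P ∈ homRat Φ₁ Φ₂)
    (hQP : Q * P = 1) (hPQ : P * Q = 1) (e : ι₁ ≃ ι₂) :
    (isZConnected_map_toGL_hodgeGroupC Φ₂).zdim = (isZConnected_map_toGL_hodgeGroupC Φ₁).zdim := by
  have hdet := isUnit_det_submatrix_map_algebraMap hPQ e
  have hZ₁ := (isZConnected_map_toGL_hodgeGroupC Φ₁).map_reindexGL e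
  have hZ := hZ₁.map_conj (Matrix.GeneralLinearGroup.mk'' ((P.map (algebraMap ℚ ℂ)).submatrix id e.symm) hdet)
  calc (isZConnected_map_toGL_hodgeGroupC Φ₂).zdim = hZ.zdim :=
        (isZConnected_map_toGL_hodgeGroupC Φ₂).zdim_congr hZ (map_toGL_hodgeGroupC_eq_of_homRat hP hQP hPQ e hdet)
    _ = hZ₁.zdim := hZ₁.zdim_map_conj _
    _ = (isZConnected_map_toGL_hodgeGroupC Φ₁).zdim := (isZConnected_map_toGL_hodgeGroupC Φ₁).zdim_map_reindexGL e

/-- **`Lie Hg(X₂)(ℂ)` is simple iff `Lie Hg(X₁)(ℂ)` is**, for mutually inverse `P ∈ Hom_ℚ(X₁, X₂)`, `Q`.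
[cite: GreenGriffithsKerr2012, §I.B (I.B.4)] [cite: Springer1998, 4.4.5 (ii)] -/
theorem isSimple_lieSubalgebraGL_hodgeGroupC_iff_of_homRat {P : Matrix ι₂ ι₁ ℚ} {Q : Matrix ι₁ ι₂ ℚ}
    (hP : P ∈ homRat Φ₁ Φ₂) (hQP : Q * P = 1) (hPQ : P * Q = 1) (e : ι₁ ≃ ι₂) :
    LieAlgebra.IsSimple ℂ (lieSubalgebraGL ((hodgeGroupC Φ₂).map Matrix.SpecialLinearGroup.toGL)) ↔
      LieAlgebra.IsSimple ℂ (lieSubalgebraGL ((hodgeGroupC Φ₁).map Matrix.SpecialLinearGroup.toGL)) := by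
  rw [map_toGL_hodgeGroupC_eq_of_homRat hP hQP hPQ e (isUnit_det_submatrix_map_algebraMap hPQ e),
    Literature.NumberTheory.Automorphic.isSimple_lieSubalgebraGL_map_conj_iff,
    Literature.NumberTheory.Automorphic.isSimple_lieSubalgebraGL_map_reindexGL_iff]

/-- `Lie Hg(X₂)(ℂ)` is abelian iff `Lie Hg(X₁)(ℂ)` is, for mutually inverse `P ∈ Hom_ℚ(X₁, X₂)`, `Q`.
[cite: GreenGriffithsKerr2012, §I.B (I.B.4)] [cite: Springer1998, 4.4.5 (ii)] -/
theorem isLieAbelian_lieSubalgebraGL_hodgeGroupC_iff_of_homRat {P : Matrix ι₂ ι₁ ℚ} {Q : Matrix ι₁ ι₂ ℚ}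
    (hP : P ∈ homRat Φ₁ Φ₂) (hQP : Q * P = 1) (hPQ : P * Q = 1) (e : ι₁ ≃ ι₂) :
    IsLieAbelian (lieSubalgebraGL ((hodgeGroupC Φ₂).map Matrix.SpecialLinearGroup.toGL)) ↔
      IsLieAbelian (lieSubalgebraGL ((hodgeGroupC Φ₁).map Matrix.SpecialLinearGroup.toGL)) := by
  rw [map_toGL_hodgeGroupC_eq_of_homRat hP hQP hPQ e (isUnit_det_submatrix_map_algebraMap hPQ e),
    Literature.NumberTheory.Automorphic.isLieAbelian_lieSubalgebraGL_map_conj_iff,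
    Literature.NumberTheory.Automorphic.isLieAbelian_lieSubalgebraGL_map_reindexGL_iff]

/-- **Isogenies preserve `dim Hg(X)`.** [cite: vanGeemen1994HodgeAV, 3.6] [cite: MoonenZarhin1999LowDim, (0.2)(4)] [cite: Springer1998, 1.8.1] -/
theorem IsIsogeny.zdim_hodgeGroupC_eq {A : Matrix ι₂ ι₁ ℤ} (hA : IsIsogeny Φ₁ Φ₂ A) :
    (isZConnected_map_toGL_hodgeGroupC Φ₁).zdim = (isZConnected_map_toGL_hodgeGroupC Φ₂).zdim := by
  obtain ⟨Q, -, hQP, hPQ⟩ := hA.exists_homRat_inverse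
  exact (zdim_hodgeGroupC_eq_of_homRat hA.map_intCast_mem_homRat hQP hPQ (Fintype.equivOfCardEq hA.card_eq)).symm

/-- **Isogenies preserve "`Lie Hg(X)(ℂ)` is simple".** [cite: vanGeemen1994HodgeAV, 3.6] [cite: MoonenZarhin1999LowDim, (0.2)(4)] -/
theorem IsIsogeny.isSimple_lieSubalgebraGL_hodgeGroupC_iff {A : Matrix ι₂ ι₁ ℤ} (hA : IsIsogeny Φ₁ Φ₂ A) :
    LieAlgebra.IsSimple ℂ (lieSubalgebraGL ((hodgeGroupC Φ₁).map Matrix.SpecialLinearGroup.toGL)) ↔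
      LieAlgebra.IsSimple ℂ (lieSubalgebraGL ((hodgeGroupC Φ₂).map Matrix.SpecialLinearGroup.toGL)) := by
  obtain ⟨Q, -, hQP, hPQ⟩ := hA.exists_homRat_inverse
  exact (isSimple_lieSubalgebraGL_hodgeGroupC_iff_of_homRat hA.map_intCast_mem_homRat hQP hPQ
    (Fintype.equivOfCardEq hA.card_eq)).symm

/-- Isogenies preserve "`Lie Hg(X)(ℂ)` is abelian". [cite: vanGeemen1994HodgeAV, 3.6] [cite: MoonenZarhin1999LowDim, (0.2)(4)] -/
theorem IsIsogeny.isLieAbelian_lieSubalgebraGL_hodgeGroupC_iff {A : Matrix ι₂ ι₁ ℤ} (hA : IsIsogeny Φ₁ Φ₂ A) :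
    IsLieAbelian (lieSubalgebraGL ((hodgeGroupC Φ₁).map Matrix.SpecialLinearGroup.toGL)) ↔
      IsLieAbelian (lieSubalgebraGL ((hodgeGroupC Φ₂).map Matrix.SpecialLinearGroup.toGL)) := by
  obtain ⟨Q, -, hQP, hPQ⟩ := hA.exists_homRat_inverse
  exact (isLieAbelian_lieSubalgebraGL_hodgeGroupC_iff_of_homRat hA.map_intCast_mem_homRat hQP hPQ
    (Fintype.equivOfCardEq hA.card_eq)).symm

/-- **ISOGENOUS TORI HAVE HODGE GROUPS OF THE SAME DIMENSION.** [cite: vanGeemen1994HodgeAV, 3.6] [cite: MoonenZarhin1999LowDim, (0.2)(4)]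
[cite: GreenGriffithsKerr2012, §I.B (I.B.4)] -/
theorem IsIsogenous.zdim_hodgeGroupC_eq (h : IsIsogenous Φ₁ Φ₂) :
    (isZConnected_map_toGL_hodgeGroupC Φ₁).zdim = (isZConnected_map_toGL_hodgeGroupC Φ₂).zdim := by
  obtain ⟨A, hA⟩ := h
  exact hA.zdim_hodgeGroupC_eq

/-- Isogenous tori: `dim_ℂ Lie Hg(X₁)(ℂ) = dim_ℂ Lie Hg(X₂)(ℂ)`. [cite: vanGeemen1994HodgeAV, 3.6] [cite: Springer1998, 4.4.6] -/
theorem IsIsogenous.finrank_lieAlgebraGL_hodgeGroupC_eq (h : IsIsogenous Φ₁ Φ₂) :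
    finrank ℂ (lieAlgebraGL ((hodgeGroupC Φ₁).map Matrix.SpecialLinearGroup.toGL)) =
      finrank ℂ (lieAlgebraGL ((hodgeGroupC Φ₂).map Matrix.SpecialLinearGroup.toGL)) := by
  rw [(isZConnected_map_toGL_hodgeGroupC Φ₁).finrank_lieAlgebraGL_eq.2,
    (isZConnected_map_toGL_hodgeGroupC Φ₂).finrank_lieAlgebraGL_eq.2, h.zdim_hodgeGroupC_eq]

/-- **ISOGENOUS TORI: `Lie Hg(X₁)(ℂ)` IS SIMPLE IFF `Lie Hg(X₂)(ℂ)` IS.** [cite: vanGeemen1994HodgeAV, 3.6] [cite: MoonenZarhin1999LowDim, (0.2)(4)]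
[cite: GreenGriffithsKerr2012, §I.B (I.B.4)] -/
theorem IsIsogenous.isSimple_lieSubalgebraGL_hodgeGroupC_iff (h : IsIsogenous Φ₁ Φ₂) :
    LieAlgebra.IsSimple ℂ (lieSubalgebraGL ((hodgeGroupC Φ₁).map Matrix.SpecialLinearGroup.toGL)) ↔
      LieAlgebra.IsSimple ℂ (lieSubalgebraGL ((hodgeGroupC Φ₂).map Matrix.SpecialLinearGroup.toGL)) := by
  obtain ⟨A, hA⟩ := h
  exact hA.isSimple_lieSubalgebraGL_hodgeGroupC_iff

/-- Isogenous tori: `Lie Hg(X₁)(ℂ)` is abelian iff `Lie Hg(X₂)(ℂ)` is. [cite: vanGeemen1994HodgeAV, 3.6] [cite: MoonenZarhin1999LowDim, (0.2)(4)] -/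
theorem IsIsogenous.isLieAbelian_lieSubalgebraGL_hodgeGroupC_iff (h : IsIsogenous Φ₁ Φ₂) :
    IsLieAbelian (lieSubalgebraGL ((hodgeGroupC Φ₁).map Matrix.SpecialLinearGroup.toGL)) ↔
      IsLieAbelian (lieSubalgebraGL ((hodgeGroupC Φ₂).map Matrix.SpecialLinearGroup.toGL)) := by
  obtain ⟨A, hA⟩ := h
  exact hA.isLieAbelian_lieSubalgebraGL_hodgeGroupC_iff

/-- Isomorphic tori have Hodge groups of the same dimension. [cite: vanGeemen1994HodgeAV, 3.6] -/
theorem IsIsomorphic.zdim_hodgeGroupC_eq (h : IsIsomorphic Φ₁ Φ₂) :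
    (isZConnected_map_toGL_hodgeGroupC Φ₁).zdim = (isZConnected_map_toGL_hodgeGroupC Φ₂).zdim :=
  h.isIsogenous.zdim_hodgeGroupC_eq

/-- Isomorphic tori: `Lie Hg(X₁)(ℂ)` is simple iff `Lie Hg(X₂)(ℂ)` is. [cite: vanGeemen1994HodgeAV, 3.6] -/
theorem IsIsomorphic.isSimple_lieSubalgebraGL_hodgeGroupC_iff (h : IsIsomorphic Φ₁ Φ₂) :
    LieAlgebra.IsSimple ℂ (lieSubalgebraGL ((hodgeGroupC Φ₁).map Matrix.SpecialLinearGroup.toGL)) ↔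
      LieAlgebra.IsSimple ℂ (lieSubalgebraGL ((hodgeGroupC Φ₂).map Matrix.SpecialLinearGroup.toGL)) :=
  h.isIsogenous.isSimple_lieSubalgebraGL_hodgeGroupC_iff

/-! ## §3 Isogeny-invariant forms of the product theorems with a Lie-simple factor -/

section Product

variable {ι₃ : Type*} [Fintype ι₃] [DecidableEq ι₃] {E₃ : Type*} [NormedAddCommGroup E₃] [NormedSpace ℂ E₃]
  (Φ₃ : (ι₃ → ℝ) ≃L[ℝ] E₃)

/-- **`X₁ ∼ X₁'`, `Lie Hg(X₁)(ℂ)` simple and `dim Hg(X₂) < dim Hg(X₁)` ⟹ `Hg(X₁' × X₂) = Hg(X₁') × Hg(X₂)`** (the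
dimension route is isogeny-invariant in the first factor). [cite: MoonenZarhin1999LowDim, §3 (3.1) and (0.2)(4)] [cite: Gordon1997, §2.16 Proposition] -/
theorem IsIsogenous.hodgeGroupC_prod_eq_blockDiagProd_of_isSimple_lieSubalgebraGL_of_zdim_lt (h : IsIsogenous Φ₁ Φ₂)
    (hsimple : LieAlgebra.IsSimple ℂ (lieSubalgebraGL ((hodgeGroupC Φ₁).map Matrix.SpecialLinearGroup.toGL)))
    (hlt : (isZConnected_map_toGL_hodgeGroupC Φ₃).zdim < (isZConnected_map_toGL_hodgeGroupC Φ₁).zdim) :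
    hodgeGroupC (prodPeriod Φ₂ Φ₃) = blockDiagProd (hodgeGroupC Φ₂) (hodgeGroupC Φ₃) :=
  ComplexTorus.hodgeGroupC_prod_eq_blockDiagProd_of_isSimple_lieSubalgebraGL_of_zdim_lt Φ₂ Φ₃
    (h.isSimple_lieSubalgebraGL_hodgeGroupC_iff.1 hsimple) (by rwa [← h.zdim_hodgeGroupC_eq])

/-- `X₁ ∼ X₁'`, `Lie Hg(X₁)(ℂ)` simple and `Hg(X₂)(ℂ)` solvable ⟹ `Hg(X₁' × X₂) = Hg(X₁') × Hg(X₂)`.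
[cite: Gordon1997, §2.16 Proposition and §3 Theorem, proof] [cite: MoonenZarhin1999LowDim, §3 Theorem (2) and (0.2)(4)] -/
theorem IsIsogenous.hodgeGroupC_prod_eq_blockDiagProd_of_isSimple_lieSubalgebraGL_of_isSolvable (h : IsIsogenous Φ₁ Φ₂)
    (hsimple : LieAlgebra.IsSimple ℂ (lieSubalgebraGL ((hodgeGroupC Φ₁).map Matrix.SpecialLinearGroup.toGL)))
    (h₃ : IsSolvable ↥(hodgeGroupC Φ₃)) :
    hodgeGroupC (prodPeriod Φ₂ Φ₃) = blockDiagProd (hodgeGroupC Φ₂) (hodgeGroupC Φ₃) :=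
  ComplexTorus.hodgeGroupC_prod_eq_blockDiagProd_of_isSimple_lieSubalgebraGL_of_isSolvable Φ₂ Φ₃
    (h.isSimple_lieSubalgebraGL_hodgeGroupC_iff.1 hsimple) h₃

end Product

end ComplexTorus

end Literature.Geometry.Kaehler

end
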